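import Summits.AtomisticToContinuum.BoseEinsteinCondensation.Theorems.BECGroundStateSOSPeriodicIRBoundTwoSectorLowDefs
import Literature.MathematicalPhysics.QuantumManyBody.GroundStateDirichletForm
import HarnessLib

/-!
# Route `BECGroundStateSOS`, crux `PeriodicIRBound` (stmt-AtomisticToContinuum-3972), line `two-sector-gd-transfer` (v9) —
# stub S9c `stub_latticeSectorEnergyFinite : LatticeSectorEnergyFinite` (the dual-lattice momentum sectors have
# finite energy for integrable potentials)

Supports (does not close) stmt-AtomisticToContinuum-3972. The registered stub S9c of the v9 skeleton (statement
`LatticeSectorEnergyFinite` in `Theorems/BECGroundStateSOSPeriodicIRBoundTwoSectorLowDefs.lean` §2): for a measurable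
radial profile `v ≥ 0` with `∫_{ℝ³} v(|x|) dx < ∞`, `M ≥ 1` particles, a torus of side `L > 0` and any `n ∈ ℤ³`, the
bottom of the total-momentum sector `2πn/L` is finite, `momentumSectorEnergy v M L (2πn/L) < ⊤`.

Proof (one admissible state of the sector with finite energy): by the sector variational principle at the
normalised Bijl–Feynman plane wave `c · N_k 1`, `N_k 1 = ∑ⱼ e^{ik·xⱼ}`, `k = 2πn/L`
(`momentumSectorEnergy_latticeVec_le_planeWave`), it suffices that `periodicEnergy v (planeWave hL hM n) < ⊤`.
Pointwise on the cell the energy density of `c · N_k 1` is at most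
`|c|² M |k|² + (∑_{i<j} v^per(xᵢ - xⱼ)) · |c|² M²` — the kinetic density of `N_k 1` is the constant `M|k|²`
(`kineticDensity_planeWaveSum`, `kineticDensity_const_mul'`) and `|N_k 1| ≤ M` (`norm_planeWaveSum_le`) — and the
pair interaction of an integrable profile is integrable over the cell
(`lintegral_cellN_periodicInteraction_ne_top_of_lintegral_ne_top`), while the cell has finite volume
(`volume_cellN`). No open mathematics; the sectors are those of H. D. Cornean, J. Dereziński, P. Ziń, J. Math.
Phys. 50 (2009) 062103, §1.1, §2.7 (shape only; nothing is cited as a fact).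
-/

noncomputable section

open scoped BigOperators ENNReal ComplexConjugate
open Filter MeasureTheory

namespace Summit.AtomisticToContinuum.BoseEinsteinCondensation.Cruxes.PeriodicIRBound.TwoSectorGdTransfer

open Literature.MathematicalPhysics.QuantumManyBody.BoseGas

namespace SectorFinite

variable {M : ℕ} {L : ℝ}

/-! ### The energy density of a multiple of the Bijl–Feynman plane wave -/

/-- `|c · N_k 1|² ≤ |c|² M²` pointwise (`|N_k 1| ≤ M`). [folklore] -/
theorem nnnorm_sq_const_mul_planeWaveSum_le (c : ℂ) (L : ℝ) (n : Fin 3 → ℤ) (X : Config M) :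
    ((‖c * planeWaveSum L n X‖₊ : ℝ≥0∞)) ^ 2 ≤ ((‖c‖₊ : ℝ≥0∞)) ^ 2 * (M : ℝ≥0∞) ^ 2 := by
  rw [nnnorm_mul, ENNReal.coe_mul, mul_pow]
  gcongr
  rw [← ENNReal.coe_natCast, ENNReal.coe_le_coe, ← NNReal.coe_le_coe, coe_nnnorm, NNReal.coe_natCast]
  exact norm_planeWaveSum_le L n X

/-- The kinetic density of `c · N_k 1` is the constant `|c|² · M|k|²`, `k = 2πn/L`. [folklore] -/
theorem kineticDensity_const_mul_planeWaveSum (c : ℂ) (L : ℝ) (n : Fin 3 → ℤ) (X : Config M) :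
    kineticDensity (fun X => c * planeWaveSum L n X) X =
      ((‖c‖₊ : ℝ≥0∞)) ^ 2 * ((M : ℝ≥0∞) * ((‖latticeVec (2 * Real.pi / L) n‖₊ : ℝ≥0∞)) ^ 2) := by
  rw [kineticDensity_const_mul' c ((contDiff_planeWaveSum L n).differentiable one_ne_zero),
    kineticDensity_planeWaveSum]

/-- **Finite energy of `c · N_k 1` on the cell** for an integrable profile: the energy density is bounded by
`|c|² M|k|² + (∑_{i<j} v^per(xᵢ - xⱼ)) · |c|² M²`, the cell has finite volume and the pair interaction is
integrable over it. [folklore] -/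
theorem lintegral_energyDensity_const_mul_planeWaveSum_ne_top {v : ℝ → ℝ≥0∞} (hv : Measurable v)
    (hint : (∫⁻ x : Space, v ‖x‖) ≠ ⊤) (hL : 0 < L) (c : ℂ) (n : Fin 3 → ℤ) :
    (∫⁻ X in cellN M L, (kineticDensity (fun X => c * planeWaveSum L n X) X +
        periodicInteraction v L X * ((‖c * planeWaveSum L n X‖₊ : ℝ≥0∞)) ^ 2)) ≠ ⊤ := by
  have hC : ((‖c‖₊ : ℝ≥0∞)) ^ 2 ≠ ⊤ := ENNReal.pow_ne_top ENNReal.coe_ne_top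
  have hB : ((‖c‖₊ : ℝ≥0∞)) ^ 2 * (M : ℝ≥0∞) ^ 2 ≠ ⊤ :=
    ENNReal.mul_ne_top hC (ENNReal.pow_ne_top (ENNReal.natCast_ne_top _))
  refine ne_top_of_le_ne_top (b := ∫⁻ X in cellN M L,
      (((‖c‖₊ : ℝ≥0∞)) ^ 2 * ((M : ℝ≥0∞) * ((‖latticeVec (2 * Real.pi / L) n‖₊ : ℝ≥0∞)) ^ 2) +
        periodicInteraction v L X * (((‖c‖₊ : ℝ≥0∞)) ^ 2 * (M : ℝ≥0∞) ^ 2))) ?_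
    (lintegral_mono fun X => ?_)
  · rw [lintegral_add_left measurable_const, setLIntegral_const, volume_cellN,
      lintegral_mul_const' _ _ hB]
    exact ENNReal.add_ne_top.2
      ⟨ENNReal.mul_ne_top (ENNReal.mul_ne_top hC (ENNReal.mul_ne_top (ENNReal.natCast_ne_top _)
          (ENNReal.pow_ne_top ENNReal.coe_ne_top)))
          (ENNReal.pow_ne_top (ENNReal.pow_ne_top ENNReal.ofReal_ne_top)),
        ENNReal.mul_ne_top (lintegral_cellN_periodicInteraction_ne_top_of_lintegral_ne_top hL hv hint M) hB⟩
  · rw [kineticDensity_const_mul_planeWaveSum]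
    gcongr
    exact nnnorm_sq_const_mul_planeWaveSum_le c L n X

/-- **The normalised Bijl–Feynman plane wave has finite energy** for an integrable profile, `L > 0`, `M ≥ 1`:
`periodicEnergy v (planeWave hL hM n) < ⊤` (the state is `c · N_k 1` with `c = ‖N_k 1‖⁻¹`). [folklore] -/
theorem periodicEnergy_planeWave_ne_top {v : ℝ → ℝ≥0∞} (hv : Measurable v)
    (hint : (∫⁻ x : Space, v ‖x‖) ≠ ⊤) (hL : 0 < L) (hM : 0 < M) (n : Fin 3 → ℤ) :
    periodicEnergy v (PeriodicTrialState.planeWave hL hM n) ≠ ⊤ := by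
  set c : ℂ := ((Real.sqrt (∫⁻ X in cellN M L, ((‖planeWaveSum L n X‖₊ : ℝ≥0∞)) ^ 2).toReal)⁻¹ : ℂ)
    with hc
  have hψ : (PeriodicTrialState.planeWave hL hM n).ψ = fun X => c * planeWaveSum L n X := rfl
  unfold periodicEnergy
  rw [hψ]
  exact lintegral_energyDensity_const_mul_planeWaveSum_ne_top hv hint hL c n

end SectorFinite

/-- **Stub S9c `LatticeSectorEnergyFinite` of the v9 skeleton, proved**: for measurable `v` with
`∫ v(|x|)dx < ∞`, `M ≥ 1` particles and `L > 0`, `momentumSectorEnergy v M L (2πn/L) ≠ ⊤` for every `n ∈ ℤ³` — the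
sector variational principle at the normalised Bijl–Feynman plane wave (`momentumSectorEnergy_latticeVec_le_planeWave`),
whose energy is finite (`SectorFinite.periodicEnergy_planeWave_ne_top`). [folklore] -/
theorem stub_latticeSectorEnergyFinite : LatticeSectorEnergyFinite := by
  intro v hv hint M L hM hL n
  exact ne_top_of_le_ne_top (SectorFinite.periodicEnergy_planeWave_ne_top hv hint hL hM n)
    (momentumSectorEnergy_latticeVec_le_planeWave v hL hM n)

end Summit.AtomisticToContinuum.BoseEinsteinCondensation.Cruxes.PeriodicIRBound.TwoSectorGdTransfer

end
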